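import Summits.CriticalPhenomena.PercolationContinuityZ3.Theorems.PercNearOneGluingNoHeavyLowerTailSahiPair43LinkGreedy
import Summits.CriticalPhenomena.PercolationContinuityZ3.Theorems.PercNearOneGluingNoHeavyLowerTailSahiPair43LinkTables

/-!
# `NoHeavyLowerTail` (crux stmt-CriticalPhenomena-4575), Sahi programme: the cell `(4,3)` — **link, enumeration**: the batch pipeline
# and the antichain walk of the pair-saturation checker are sound

Support file (Sahi cell `prim-sahi`, seat `prim-sahi-typer` gen 32; `--supports stmt-CriticalPhenomena-4575`).  Pure proofs plus
bookkeeping predicates/functions (`BatchOK`, `GoodPair`, `InB`, `Covers`, `StepOK`, `nA`, `pairA`, `pairB`, `Pushed`, `NodeCov`);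
no `sorry`, standard axioms (`pushList`, `sigAdd`, `Adm` are in `…LinkTables`).

THE INVARIANT.  A state `some b` of the pipeline is a batch whose packed masks are lane vectors of masks `< 2^81` (`BatchOK`); a pair of
masks is COVERED by `b` if it occupies a lane of `b` or its y-profile is already known to lie in the dual cone (`Covers`).  Every stage
(`pushPair`, `colourStep`, `nodeColourings`, `nodeStep`, `walk`) maps `none ↦ none`, and from `some b` to `some b'` keeps everything
covered (`StepOK`, using `packedTest_sound` when a full batch is flushed) and covers what it pushes:
* `colourStep_spec`: the pair `(pairA, pairB)` of a colouring that passes both filters (`Pushed`) is covered;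
* `nodeColourings_spec`, `nodeStep_spec`: every pushed colouring `mm < 2^(n-1)` of a processed node is covered (`NodeCov`);
* **`walk_spec`**: from `(pts, cand)` with all candidates in `[L, 81)` and `fuel + L ≥ 82`, every ADMISSIBLE extension
  (`Adm cand [x₁,…,x_k]`: `x₁ ∈ cand`, `x₂ ∈ cand ∩ nextT[x₁]`, …) is processed as the node `pushList pts [x₁,…]` with the accumulated
  signature (`sigAdd`) — by induction on `fuel`, using that `lowBit` picks the LOWEST candidate (`lowBit_spec`);
* **`chunkCheck_sound`**: if `chunkCheck m r = true`, then for every nonempty admissible code list whose node has sorted signature and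
  hash `≡ r (mod m)`, every pushed colouring gives a `GoodPair`. [this work]
-/

namespace Summit.CriticalPhenomena.PercolationContinuityZ3.Theorems.SahiGridPattern.Pair43

open Finset SahiGrid3 SahiGridPattern
open scoped BigOperators

/-! ### Batches and coverage -/

/-- `BatchOK b`: the packed masks of `b` are lane vectors of `b.n` masks `< 2^81`. [this work] -/
def BatchOK (b : Batch) : Prop :=
  ∃ fA fB : ℕ → ℕ, b.pa = ofLanes b.n fA ∧ b.pb = ofLanes b.n fB ∧ ∀ i < b.n, fA i < 2 ^ 81 ∧ fB i < 2 ^ 81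

/-- `GoodPair a c`: the y-profile of the pair of represented finsets lies in the dual cone of the up-sets. [this work] -/
def GoodPair (a c : ℕ) : Prop := InDual (yProfile (maskSet a) (maskSet c))

/-- `InB b a c`: the pair of masks `(a, c)` occupies a lane of the batch `b`. [this work] -/
def InB (b : Batch) (a c : ℕ) : Prop := ∃ i < b.n, laneOf b.pa i = a ∧ laneOf b.pb i = c

/-- `Covers b a c`: the pair is in a lane of `b`, or already good. [this work] -/
def Covers (b : Batch) (a c : ℕ) : Prop := InB b a c ∨ GoodPair a c

/-- `StepOK b b'`: `b'` is a valid batch covering everything `b` covers. [this work] -/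
def StepOK (b b' : Batch) : Prop := BatchOK b' ∧ ∀ a c, Covers b a c → Covers b' a c

/-- Reflexivity. [this work] -/
theorem stepOK_refl {b : Batch} (hb : BatchOK b) : StepOK b b := ⟨hb, fun _ _ h => h⟩

/-- Transitivity. [this work] -/
theorem StepOK.trans {b b' b'' : Batch} (h1 : StepOK b b') (h2 : StepOK b' b'') : StepOK b b'' :=
  ⟨h2.1, fun a c h => h2.2 a c (h1.2 a c h)⟩

/-- The empty batch is valid. [this work] -/
theorem batchOK_empty : BatchOK Batch.empty :=
  ⟨fun _ => 0, fun _ => 0, by rw [Batch.empty, ofLanes_zero], by rw [Batch.empty, ofLanes_zero], fun i hi => absurd hi (Nat.not_lt_zero i)⟩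

/-- Nothing occupies a lane of the empty batch. [this work] -/
theorem not_inB_empty (a c : ℕ) : ¬ InB Batch.empty a c := fun ⟨i, hi, _⟩ => Nat.not_lt_zero i hi

/-- In a valid batch that passes `packedTest`, every occupied lane is a good pair. [this work] -/
theorem good_of_inB {b : Batch} (hb : BatchOK b) (ht : packedTest b = true) {a c : ℕ} (h : InB b a c) : GoodPair a c := by
  obtain ⟨fA, fB, hpa, hpb, hf⟩ := hb
  obtain ⟨i, hi, ha, hc⟩ := h
  have hA : ∀ i < b.n, fA i < 2 ^ 81 := fun i hi => (hf i hi).1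
  have hB : ∀ i < b.n, fB i < 2 ^ 81 := fun i hi => (hf i hi).2
  rw [hpa, laneOf_ofLanes (fun i hi => (hA i hi).trans_le pow81_le) hi] at ha
  rw [hpb, laneOf_ofLanes (fun i hi => (hB i hi).trans_le pow81_le) hi] at hc
  subst ha; subst hc
  exact packedTest_sound hpa hpb hA hB ht i hi

/-- **Appending a pair**: the batch stays valid, old lanes are kept, the new pair occupies a lane. [this work] -/
theorem push_spec {b : Batch} (hb : BatchOK b) {a c : ℕ} (ha : a < 2 ^ 81) (hc : c < 2 ^ 81) :
    BatchOK (b.push a c) ∧ (∀ a' c', InB b a' c' → InB (b.push a c) a' c') ∧ InB (b.push a c) a c := by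
  obtain ⟨fA, fB, hpa, hpb, hf⟩ := hb
  let fA' : ℕ → ℕ := fun i => if i = b.n then a else fA i
  let fB' : ℕ → ℕ := fun i => if i = b.n then c else fB i
  have hf' : ∀ i < b.n + 1, fA' i < 2 ^ 81 ∧ fB' i < 2 ^ 81 := fun i hi => by
    by_cases h : i = b.n
    · subst h; simp only [fA', fB', if_pos rfl]; exact ⟨ha, hc⟩
    · have hi' : i < b.n := by omega
      simp only [fA', fB', if_neg h]; exact hf i hi'
  have ePA : (b.push a c).pa = ofLanes (b.n + 1) fA' := by
    show b.pa + (a <<< (LW * b.n)) = _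
    rw [ofLanes_succ, hpa, Nat.shiftLeft_eq]
    congr 1
    · exact ofLanes_congr fun i hi => by simp only [fA', if_neg (Nat.ne_of_lt hi)]
    · simp only [fA', if_pos rfl]
  have ePB : (b.push a c).pb = ofLanes (b.n + 1) fB' := by
    show b.pb + (c <<< (LW * b.n)) = _
    rw [ofLanes_succ, hpb, Nat.shiftLeft_eq]
    congr 1
    · exact ofLanes_congr fun i hi => by simp only [fB', if_neg (Nat.ne_of_lt hi)]
    · simp only [fB', if_pos rfl]
  have hn : (b.push a c).n = b.n + 1 := rfl
  have hL' : ∀ i < b.n + 1, fA' i < 2 ^ LW := fun i hi => (hf' i hi).1.trans_le pow81_le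
  have hL'' : ∀ i < b.n + 1, fB' i < 2 ^ LW := fun i hi => (hf' i hi).2.trans_le pow81_le
  refine ⟨⟨fA', fB', ePA, ePB, hf'⟩, fun a' c' ⟨i, hi, ha', hc'⟩ => ⟨i, by rw [hn]; omega, ?_, ?_⟩, ⟨b.n, by rw [hn]; omega, ?_, ?_⟩⟩
  · rw [ePA, laneOf_ofLanes hL' (by omega)]
    rw [hpa, laneOf_ofLanes (fun i hi => (hf i hi).1.trans_le pow81_le) hi] at ha'
    simp only [fA', if_neg (Nat.ne_of_lt hi), ha']
  · rw [ePB, laneOf_ofLanes hL'' (by omega)]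
    rw [hpb, laneOf_ofLanes (fun i hi => (hf i hi).2.trans_le pow81_le) hi] at hc'
    simp only [fB', if_neg (Nat.ne_of_lt hi), hc']
  · rw [ePA, laneOf_ofLanes hL' (Nat.lt_succ_self _)]; simp only [fA', if_pos rfl]
  · rw [ePB, laneOf_ofLanes hL'' (Nat.lt_succ_self _)]; simp only [fB', if_pos rfl]

/-- **`pushPair`**: on success everything stays covered and the pushed pair is covered. [this work] -/
theorem pushPair_spec {b b' : Batch} (hb : BatchOK b) {a c : ℕ} (ha : a < 2 ^ 81) (hc : c < 2 ^ 81)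
    (h : pushPair b a c = some b') : StepOK b b' ∧ Covers b' a c := by
  obtain ⟨hok, hkeep, hnew⟩ := push_spec hb ha hc
  unfold pushPair at h
  simp only [] at h
  split at h
  · cases h
    exact ⟨⟨hok, fun a' c' hcv => hcv.elim (fun hin => Or.inl (hkeep a' c' hin)) Or.inr⟩, Or.inl hnew⟩
  · split at h
    · rename_i ht
      cases h
      refine ⟨⟨batchOK_empty, fun a' c' hcv => Or.inr (hcv.elim (fun hin => good_of_inB hok ht (hkeep a' c' hin)) id)⟩,
        Or.inr (good_of_inB hok ht hnew)⟩
    · cases h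

/-! ### Colourings of a node -/

/-- Number of first-class points of the colouring `mm` of an `n`-point node. [this work] -/
def nA (n mm : ℕ) : ℕ := 1 + countBelow (n - 1) fun j => mm.testBit j

/-- The first mask pushed for the colouring `mm` of the node `pts`. [this work] -/
def pairA (pts : Array ℕ) (mm : ℕ) : ℕ := compl81 (classDown pts mm pts.size).1

/-- The second mask pushed for the colouring `mm` of the node `pts`. [this work] -/
def pairB (pts : Array ℕ) (mm : ℕ) : ℕ := compl81 (classDown pts mm pts.size).2

/-- `Pushed pts f upN mm`: the colouring passes the class-size filter and the minimal-element filter. [this work] -/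
def Pushed (pts : Array ℕ) (f upN mm : ℕ) : Prop :=
  ¬ (f < nA pts.size mm ∨ f < pts.size - nA pts.size mm) ∧ p2bad (pairA pts mm) (pairB pts mm) upN = false

/-- `colourStep` maps `none` to `none`. [this work] -/
theorem colourStep_none (pts : Array ℕ) (f upN mm : ℕ) : colourStep pts f upN mm none = none := rfl

/-- **`colourStep`**: everything stays covered, and a pushed colouring is covered. [this work] -/
theorem colourStep_spec {pts : Array ℕ} {f upN mm : ℕ} {b b' : Batch} (hb : BatchOK b)
    (h : colourStep pts f upN mm (some b) = some b') :
    StepOK b b' ∧ (Pushed pts f upN mm → Covers b' (pairA pts mm) (pairB pts mm)) := by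
  unfold colourStep at h
  simp only [] at h
  split at h
  · rename_i hfilt
    cases h
    exact ⟨stepOK_refl hb, fun hp => absurd hfilt (by unfold Pushed nA at hp; exact hp.1)⟩
  · rename_i hfilt
    split at h
    · rename_i hbad
      cases h
      refine ⟨stepOK_refl hb, fun hp => ?_⟩
      unfold Pushed pairA pairB at hp
      rw [hp.2] at hbad
      exact absurd hbad Bool.false_ne_true
    · have H := pushPair_spec hb (compl81_lt _) (compl81_lt _) h
      exact ⟨H.1, fun _ => H.2⟩

/-- The fold over the colouring codes: everything stays covered and every pushed code `< K` is covered. [this work] -/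
theorem foldBelow_colour_spec (pts : Array ℕ) (f upN : ℕ) : ∀ (K : ℕ) (b b' : Batch), BatchOK b →
    foldBelow K (colourStep pts f upN) (some b) = some b' →
    StepOK b b' ∧ ∀ mm < K, Pushed pts f upN mm → Covers b' (pairA pts mm) (pairB pts mm)
  | 0, b, b', hb, h => by
    cases h
    exact ⟨stepOK_refl hb, fun mm hmm => absurd hmm (Nat.not_lt_zero _)⟩
  | K + 1, b, b', hb, h => by
    change colourStep pts f upN K (foldBelow K (colourStep pts f upN) (some b)) = some b' at h
    cases hmid : foldBelow K (colourStep pts f upN) (some b) with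
    | none => rw [hmid, colourStep_none] at h; cases h
    | some b1 =>
      rw [hmid] at h
      obtain ⟨hs1, hcov1⟩ := foldBelow_colour_spec pts f upN K b b1 hb hmid
      obtain ⟨hs2, hcov2⟩ := colourStep_spec hs1.1 h
      refine ⟨hs1.trans hs2, fun mm hmm hp => ?_⟩
      rcases Nat.lt_succ_iff_lt_or_eq.1 hmm with hmm | rfl
      · exact hs2.2 _ _ (hcov1 mm hmm hp)
      · exact hcov2 hp

/-- `nodeColourings` maps `none` to `none`. [this work] -/
theorem nodeColourings_none (pts : Array ℕ) : nodeColourings pts none = none := by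
  unfold nodeColourings
  split
  · rfl
  · simp only []
    generalize (1 <<< (pts.size - 1)) = K
    induction K with
    | zero => rfl
    | succ K ih => show colourStep pts _ _ K (foldBelow K _ none) = none; rw [ih]; rfl

/-- `NodeCov m r b pts s0 s1 s2 s3`: if the node `pts` with signature `(s0,s1,s2,s3)` is selected (sorted signature, hash `≡ r`), then
every pushed colouring of it is covered by `b`. [this work] -/
def NodeCov (m r : ℕ) (b : Batch) (pts : Array ℕ) (s0 s1 s2 s3 : ℕ) : Prop :=
  (s0 ≤ s1 ∧ s1 ≤ s2 ∧ s2 ≤ s3 ∧ ptsHash pts % m = r) → pts.size ≠ 0 →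
    ∀ mm < 2 ^ (pts.size - 1), Pushed pts (chainCount (compl81 (orTab cmpT pts))) (orTab upT pts) mm →
      Covers b (pairA pts mm) (pairB pts mm)

/-- `NodeCov` persists along `StepOK`. [this work] -/
theorem NodeCov.mono {m r : ℕ} {b b' : Batch} {pts : Array ℕ} {s0 s1 s2 s3 : ℕ} (h : NodeCov m r b pts s0 s1 s2 s3)
    (hs : StepOK b b') : NodeCov m r b' pts s0 s1 s2 s3 :=
  fun hc hn mm hmm hp => hs.2 _ _ (h hc hn mm hmm hp)

/-- **`nodeColourings`**: everything stays covered; every pushed colouring of a nonempty node is covered. [this work] -/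
theorem nodeColourings_spec {pts : Array ℕ} {b b' : Batch} (hb : BatchOK b) (h : nodeColourings pts (some b) = some b') :
    StepOK b b' ∧ (pts.size ≠ 0 → ∀ mm < 2 ^ (pts.size - 1),
      Pushed pts (chainCount (compl81 (orTab cmpT pts))) (orTab upT pts) mm → Covers b' (pairA pts mm) (pairB pts mm)) := by
  unfold nodeColourings at h
  split at h
  · rename_i h0
    cases h
    exact ⟨stepOK_refl hb, fun hn => absurd h0 hn⟩
  · simp only [] at h
    rw [Nat.one_shiftLeft] at h
    obtain ⟨hs, hcov⟩ := foldBelow_colour_spec pts _ _ _ b b' hb h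
    exact ⟨hs, fun _ => hcov⟩

/-- `nodeStep` maps `none` to `none`. [this work] -/
theorem nodeStep_none (m r : ℕ) (pts : Array ℕ) (s0 s1 s2 s3 : ℕ) : nodeStep m r pts s0 s1 s2 s3 none = none := by
  unfold nodeStep; split
  · exact nodeColourings_none pts
  · rfl

/-- **`nodeStep`**: everything stays covered and the node is covered. [this work] -/
theorem nodeStep_spec {m r : ℕ} {pts : Array ℕ} {s0 s1 s2 s3 : ℕ} {b b' : Batch} (hb : BatchOK b)
    (h : nodeStep m r pts s0 s1 s2 s3 (some b) = some b') : StepOK b b' ∧ NodeCov m r b' pts s0 s1 s2 s3 := by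
  unfold nodeStep at h
  split at h
  · obtain ⟨hs, hcov⟩ := nodeColourings_spec hb h
    exact ⟨hs, fun _ hn => hcov hn⟩
  · rename_i hc
    cases h
    refine ⟨stepOK_refl hb, fun hc' => absurd ?_ hc⟩
    obtain ⟨h1, h2, h3, h4⟩ := hc'
    simp [h1, h2, h3, h4]

/-! ### The walk -/

/-- `walk` maps `none` to `none`. [this work] -/
theorem walk_none (m r : ℕ) : ∀ (fuel : ℕ) (pts : Array ℕ) (s0 s1 s2 s3 cand : ℕ),
    walk m r fuel pts s0 s1 s2 s3 cand none = none
  | 0, _, _, _, _, _, _ => rfl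
  | _ + 1, _, _, _, _, _, _ => rfl

/-- Removing the lowest candidate does not change the candidates above a higher code. [this work] -/
theorem xor_low_and_nextT {cand x y : ℕ} (hy : y < 81) (hxy : x < y) :
    (cand ^^^ (1 <<< x)) &&& nextT.getD y 0 = cand &&& nextT.getD y 0 := by
  apply Nat.eq_of_testBit_eq
  intro j
  rw [Nat.testBit_and, Nat.testBit_and, Nat.testBit_xor, Nat.one_shiftLeft, Nat.testBit_two_pow]
  by_cases hj : x = j
  · subst hj
    rw [testBit_nextT hy]
    have : ¬ y < x := Nat.not_lt_of_lt hxy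
    simp [this]
  · simp [hj]

/-- **The walk is sound and complete**: from `(pts, cand)` with all candidates in `[L, 81)` and enough fuel, everything stays covered
and every admissible extension is processed as a node. [this work] -/
theorem walk_spec (m r : ℕ) : ∀ (fuel L : ℕ) (pts : Array ℕ) (s0 s1 s2 s3 cand : ℕ) (b b' : Batch),
    (∀ y, cand.testBit y = true → L ≤ y ∧ y < 81) → 82 ≤ fuel + L → BatchOK b →
    walk m r fuel pts s0 s1 s2 s3 cand (some b) = some b' →
    StepOK b b' ∧ ∀ E : List ℕ, E ≠ [] → Adm cand E →
      NodeCov m r b' (pushList pts E) (sigAdd s0 0 E) (sigAdd s1 1 E) (sigAdd s2 2 E) (sigAdd s3 3 E)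
  | 0 => by
    intro L pts s0 s1 s2 s3 cand b b' hcand hfuel hb h
    cases h
    refine ⟨stepOK_refl hb, fun E hE hadm => ?_⟩
    cases E with
    | nil => exact absurd rfl hE
    | cons x E' =>
      have := (hcand x hadm.1).1; have := (hcand x hadm.1).2; omega
  | fuel + 1 => by
    intro L pts s0 s1 s2 s3 cand b b' hcand hfuel hb h
    rw [walk] at h
    simp only [] at h
    split at h
    · rename_i hc0
      cases h
      refine ⟨stepOK_refl hb, fun E hE hadm => ?_⟩
      cases E with
      | nil => exact absurd rfl hE
      | cons x E' => have := hadm.1; rw [hc0, Nat.zero_testBit] at this; exact absurd this Bool.false_ne_true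
    · rename_i hc0
      -- the lowest candidate
      obtain ⟨hxbit, hxlow⟩ := lowBit_spec hc0
      set x := lowBit cand with hxdef
      obtain ⟨hLx, hx81⟩ := hcand x hxbit
      -- candidates of the two branches lie in `[x+1, 81)`
      have hcand1 : ∀ y, (cand &&& nextT.getD x 0).testBit y = true → x + 1 ≤ y ∧ y < 81 := by
        intro y hy
        rw [Nat.testBit_and, Bool.and_eq_true, testBit_nextT hx81] at hy
        have h2 := hy.2
        simp only [Bool.and_eq_true, decide_eq_true_eq] at h2
        exact ⟨h2.2.1.1, (hcand y hy.1).2⟩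
      have hcand2 : ∀ y, (cand ^^^ (1 <<< x)).testBit y = true → x + 1 ≤ y ∧ y < 81 := by
        intro y hy
        rw [Nat.testBit_xor, Nat.one_shiftLeft, Nat.testBit_two_pow] at hy
        by_cases hyx : x = y
        · subst hyx; rw [hxbit] at hy; simp at hy
        · have hy' : cand.testBit y = true := by simpa [hyx] using hy
          refine ⟨?_, (hcand y hy').2⟩
          by_contra hlt
          have : y < x := by omega
          rw [hxlow y this] at hy'
          exact Bool.false_ne_true hy'
      have hfuel' : 82 ≤ fuel + (x + 1) := by omega
      -- the three stages must all succeed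
      cases hob1 : nodeStep m r (pts.push x) (s0 + sw 0 x) (s1 + sw 1 x) (s2 + sw 2 x) (s3 + sw 3 x) (some b) with
      | none => rw [hob1, walk_none, walk_none] at h; cases h
      | some b1 =>
        rw [hob1] at h
        obtain ⟨hs1, hnode⟩ := nodeStep_spec hb hob1
        cases hob2 : walk m r fuel (pts.push x) (s0 + sw 0 x) (s1 + sw 1 x) (s2 + sw 2 x) (s3 + sw 3 x)
            (cand &&& nextT.getD x 0) (some b1) with
        | none => rw [hob2, walk_none] at h; cases h
        | some b2 =>
          rw [hob2] at h
          obtain ⟨hs2, hcov2⟩ := walk_spec m r fuel (x + 1) _ _ _ _ _ _ b1 b2 hcand1 hfuel' hs1.1 hob2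
          obtain ⟨hs3, hcov3⟩ := walk_spec m r fuel (x + 1) _ _ _ _ _ _ b2 b' hcand2 hfuel' hs2.1 h
          refine ⟨(hs1.trans hs2).trans hs3, fun E hE hadm => ?_⟩
          cases E with
          | nil => exact absurd rfl hE
          | cons y E' =>
            obtain ⟨hybit, hadm'⟩ := hadm
            by_cases hyx : y = x
            · subst hyx
              by_cases hE' : E' = []
              · subst hE'
                exact (hnode.mono hs2).mono hs3
              · exact (hcov2 E' hE' hadm').mono hs3
            · -- `y` is a higher candidate: the node is reached in the second branch
              have hy81 := (hcand y hybit).2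
              have hxy : x < y := by
                by_contra hle
                have hlt : y < x := by omega
                rw [hxlow y hlt] at hybit; exact Bool.false_ne_true hybit
              refine hcov3 (y :: E') (List.cons_ne_nil _ _) ⟨?_, ?_⟩
              · rw [Nat.testBit_xor, Nat.one_shiftLeft, Nat.testBit_two_pow, hybit]; simp [Ne.symm hyx]
              · rw [xor_low_and_nextT hy81 hxy]; exact hadm'

/-- `nodeStep` on the empty node does nothing. [this work] -/
theorem nodeStep_nil (m r s0 s1 s2 s3 : ℕ) (ob : Option Batch) : nodeStep m r #[] s0 s1 s2 s3 ob = ob := by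
  unfold nodeStep nodeColourings; simp

/-- **Soundness of `chunkCheck`**: every pushed colouring of every selected nonempty admissible node is a good pair. [this work] -/
theorem chunkCheck_sound {m r : ℕ} (h : chunkCheck m r = true) {E : List ℕ} (hE : E ≠ []) (hadm : Adm FULL E)
    (hsel : sigAdd 0 0 E ≤ sigAdd 0 1 E ∧ sigAdd 0 1 E ≤ sigAdd 0 2 E ∧ sigAdd 0 2 E ≤ sigAdd 0 3 E ∧
      ptsHash (pushList #[] E) % m = r)
    (hn : (pushList #[] E).size ≠ 0) {mm : ℕ} (hmm : mm < 2 ^ ((pushList #[] E).size - 1))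
    (hp : Pushed (pushList #[] E) (chainCount (compl81 (orTab cmpT (pushList #[] E)))) (orTab upT (pushList #[] E)) mm) :
    GoodPair (pairA (pushList #[] E) mm) (pairB (pushList #[] E) mm) := by
  unfold chunkCheck at h
  rw [nodeStep_nil] at h
  have hcand : ∀ y, FULL.testBit y = true → 0 ≤ y ∧ y < 81 := fun y hy => by
    rw [testBit_FULL] at hy; exact ⟨Nat.zero_le _, of_decide_eq_true hy⟩
  split at h
  · exact absurd h Bool.false_ne_true
  · rename_i b' hw
    obtain ⟨hs, hcov⟩ := walk_spec m r 83 0 #[] 0 0 0 0 FULL Batch.empty b' hcand (by norm_num) batchOK_empty hw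
    rcases hcov E hE hadm hsel hn mm hmm hp with hin | hgood
    · exact good_of_inB hs.1 h hin
    · exact hgood

end Summit.CriticalPhenomena.PercolationContinuityZ3.Theorems.SahiGridPattern.Pair43
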